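import Literature.NumberTheory.EllipticCurves.EisensteinNumberDistribution
import Literature.NumberTheory.EllipticCurves.GaussianLatticeHeckeLValue
import Literature.NumberTheory.EllipticCurves.EisensteinValuesAtRhoSix
import HarnessLib

/-!
# The Eisenstein number `E₁(z; L)` of a REAL lattice commutes with complex conjugation

Topic `Literature/NumberTheory/EllipticCurves` (complex-lattice cluster); theorems only, deliberate dot-notation extensions of Mathlib's
`PeriodPair` (continuing `EisensteinNumberDistribution.lean`, `GaussianLatticeHeckeLValue.lean`). For a lattice `L` stable under complex
conjugation (`PeriodPair.IsReal`, the period lattices of elliptic curves over `ℝ`) the tree has `ζ(conj z; L) = conj ζ(z; L)`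
(`PeriodPair.IsReal.weierstrassZeta_conj`); here the same for Silverman's `ℝ`-linear quasi-period map `η` (`PeriodPair.quasiPeriodMap`,
through the quasi-periodicity `ζ(z + ω) = ζ(z) + η(ω)` on `Λ` and `ℝ`-linearity on the real basis `(ω₁, ω₂)`) and hence for Rubin's
weight-one Eisenstein number `E₁ = ζ − η` (`PeriodPair.eisensteinE₁`):

* `PeriodPair.IsReal.quasiPeriodMap_conj` — `η(conj z; L) = conj η(z; L)`;
* ★ `PeriodPair.IsReal.eisensteinE₁_conj` — `E₁(conj z; L) = conj E₁(z; L)`;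
* `EisensteinLattice.eisensteinE₁_conj` — the case `L = ℤρ + ℤ` (the CM lattice of `y² = x³ + k`), the `j = 0` twin of
  `GaussianLattice.conj_kroneckerE₁`.
[cite: Silverman1994, Prop VI.3.1] [cite: Rubin1999, §7.4 Def. 7.11 and Prop. 7.12]
-/

noncomputable section

open Complex
open scoped ComplexConjugate

namespace PeriodPair

variable {L : PeriodPair}

/-- **`η(conj z; L) = conj η(z; L)` for a real lattice** (`η` the `ℝ`-linear quasi-period map): on `Λ` from `ζ(z + ω) = ζ(z) + η(ω)` and
`ζ(conj z) = conj ζ(z)`, then by `ℝ`-linearity on the real basis `(ω₁, ω₂)` of `ℂ`. [cite: Silverman1994, Prop VI.3.1] -/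
theorem IsReal.quasiPeriodMap_conj (h : L.IsReal) (z : ℂ) :
    L.quasiPeriodMap (conj z) = conj (L.quasiPeriodMap z) := by
  have key : ∀ ω ∈ L.lattice, L.quasiPeriodMap (conj ω) = conj (L.quasiPeriodMap ω) := by
    intro ω hω
    have h1 := L.weierstrassZeta_add_of_mem_lattice (h ω hω) (conj 0)
    rw [← map_add, h.weierstrassZeta_conj, h.weierstrassZeta_conj, L.weierstrassZeta_add_of_mem_lattice hω 0, map_add]
      at h1
    exact ((add_right_inj _).mp h1).symm
  have hlin : L.quasiPeriodMap ∘ₗ Complex.conjAe.toLinearMap = Complex.conjAe.toLinearMap ∘ₗ L.quasiPeriodMap := by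
    refine L.basis.ext fun i ↦ ?_
    fin_cases i
    · simpa using key L.ω₁ L.ω₁_mem_lattice
    · simpa using key L.ω₂ L.ω₂_mem_lattice
  simpa using LinearMap.congr_fun hlin z

/-- ★ **`E₁(conj z; L) = conj E₁(z; L)` for a real lattice** (`E₁ = ζ − η`, Rubin's weight-one Eisenstein number).
[cite: Rubin1999, §7.4 Def. 7.11 and Prop. 7.12] -/
theorem IsReal.eisensteinE₁_conj (h : L.IsReal) (z : ℂ) :
    L.eisensteinE₁ (conj z) = conj (L.eisensteinE₁ z) := by
  rw [eisensteinE₁_def, eisensteinE₁_def, h.weierstrassZeta_conj, h.quasiPeriodMap_conj, map_sub]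

end PeriodPair

namespace Literature.NumberTheory.EllipticCurves

namespace EisensteinLattice

/-- `E₁(conj z; ℤρ + ℤ) = conj E₁(z; ℤρ + ℤ)` (`ℤρ + ℤ` is a real lattice, `EisensteinLattice.isReal`). [cite: Rubin1999, §7.4 Prop. 7.12] -/
theorem eisensteinE₁_conj (z : ℂ) :
    (PeriodPair.ofUpperHalfPlane UpperHalfPlane.ρ).eisensteinE₁ (conj z) =
      conj ((PeriodPair.ofUpperHalfPlane UpperHalfPlane.ρ).eisensteinE₁ z) :=
  isReal.eisensteinE₁_conj z

end EisensteinLattice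

end Literature.NumberTheory.EllipticCurves

end
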